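import Mathlib
import Literature.Computability.AlgebraicComplexity.NewtonPolygonTauProductBounds
import HarnessLib

/-!
# Crux `NewtonUnitEquations.DissociatedUniform` (stmt-ValiantsHypothesis-5905): faces, edge normals and edge ends of finite planar
# sets — TOOLS for the exact vertex count of a planar Minkowski sum (the count itself is in the follow-up `…TotalsLawMinkowskiExactCount`)

Tool file for the product construction against the refinement `FibreSumDominance C` (companions `…TotalsLawFibreSumWitness`,
`…TotalsLawFibreSumWitness8`): over a product group `G₁ × G₂` every class and every fibre is a Minkowski sum, so the totals need a LOWER
Minkowski bound `V(X) + V(Y) ≤ V(X + Y)` (no parallel chords) to complement the tree's upper bound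
`KPTT.PlanarMinkowski.ncard_extremePoints_add_le`.  THIS file contains only the vocabulary and the local facts; the vertex→edge-end
lemma and the count are proved in the follow-up file.

* `perp n` (rotation by `+π/2`), `cross`, `SameDir n n'` (positive multiples), `normSq_pos`, `eq_of_dot_eq` (a vector is determined by
  its pairings with `n ≠ 0` and `perp n`), `det_identity`, `cross_eq_zero_of_dot_eq_zero` (two vectors orthogonal to `n ≠ 0` are parallel);
* `face F n` (the points of the finite set `F` maximising `⟨n, ·⟩`), `IsEdgeNormal F n` (`n ≠ 0` and the face has two distinct points —
  `conv F` has an edge with outward normal `n`), `IsEnd F n p` (`p` is the strict `perp n`-top of that face, over the Literature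
  `IsStrictTop`), `exists_isEnd` (every direction `n ≠ 0` has an end), `face_smul` / `IsEnd.of_sameDir` (positive rescaling);
* `IsEnd.mem_extremePoints` (ends are hull vertices: strict tops of `n + ε·perp n`), `sameDir_of_isEnd` (two edge normals with the same
  end are positive multiples), `card_le_ncard_extremePoints` (a family of edge normals, pairwise not positive multiples, with ends, is no
  larger than the vertex count), `mem_face_add` / `face_add` / `IsEnd.add` / `IsEdgeNormal.add_right|add_left` (faces of `X + Y` add up).
All folklore (edges of a Minkowski sum of polygons are the translated edges of the summands).  Nothing here bears on VP ≠ VNP.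
[folklore]
-/

set_option linter.dupNamespace false -- `ValiantsHypothesis.ValiantsHypothesis` (summit = problem) in every name

open scoped BigOperators Pointwise

namespace Summit.ValiantsHypothesis.ValiantsHypothesis.Theorems.NewtonUnitEquationsDissociatedUniform

namespace TotalsLaw

namespace MinkowskiExact

open Literature.Computability.AlgebraicComplexity.KPTT.PlanarMinkowski

/-! ### Planar vector algebra -/

/-- Rotation by `+π/2`. -/
def perp (n : Fin 2 → ℝ) : Fin 2 → ℝ := ![-(n 1), n 0]

/-- The planar cross product `a₀ b₁ − a₁ b₀`. -/
def cross (a b : Fin 2 → ℝ) : ℝ := a 0 * b 1 - a 1 * b 0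

/-- `n'` is a positive multiple of `n`. -/
def SameDir (n n' : Fin 2 → ℝ) : Prop := ∃ c : ℝ, 0 < c ∧ n' = c • n

/-- The planar pairing in coordinates. [folklore] -/
theorem dot_two (a b : Fin 2 → ℝ) : a ⬝ᵥ b = a 0 * b 0 + a 1 * b 1 := by
  simp [dotProduct, Fin.sum_univ_two]

/-- First coordinate of `perp`. [folklore] -/
@[simp] theorem perp_zero (n : Fin 2 → ℝ) : perp n 0 = -(n 1) := rfl
/-- Second coordinate of `perp`. [folklore] -/
@[simp] theorem perp_one (n : Fin 2 → ℝ) : perp n 1 = n 0 := rfl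

/-- `⟨n, perp n'⟩ = −⟨n', perp n⟩`. [folklore] -/
theorem dot_perp_comm (n n' : Fin 2 → ℝ) : n ⬝ᵥ perp n' = -(n' ⬝ᵥ perp n) := by
  rw [dot_two, dot_two]; simp; ring

/-- `⟨perp n, d⟩ = cross n d`. [folklore] -/
theorem perp_dot (n d : Fin 2 → ℝ) : perp n ⬝ᵥ d = cross n d := by
  rw [dot_two, cross]; simp; ring

/-- A non-zero planar vector has positive squared norm. [folklore] -/
theorem normSq_pos {n : Fin 2 → ℝ} (hn : n ≠ 0) : 0 < n 0 ^ 2 + n 1 ^ 2 := by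
  by_contra hle
  rw [not_lt] at hle
  have h0 : n 0 = 0 := by nlinarith [sq_nonneg (n 0), sq_nonneg (n 1)]
  have h1 : n 1 = 0 := by nlinarith [sq_nonneg (n 0), sq_nonneg (n 1)]
  exact hn (by ext i; fin_cases i <;> simp [h0, h1])

/-- A vector is determined by its pairings with `n ≠ 0` and `perp n`. [folklore] -/
theorem eq_of_dot_eq {n y y' : Fin 2 → ℝ} (hn : n ≠ 0) (h1 : n ⬝ᵥ y = n ⬝ᵥ y') (h2 : perp n ⬝ᵥ y = perp n ⬝ᵥ y') :
    y = y' := by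
  rw [dot_two, dot_two] at h1
  rw [dot_two, dot_two, perp_zero, perp_one] at h2
  have hn2 : n 0 ^ 2 + n 1 ^ 2 ≠ 0 := (normSq_pos hn).ne'
  have e0 : (n 0 ^ 2 + n 1 ^ 2) * (y 0 - y' 0) = 0 := by linear_combination (n 0) * h1 - (n 1) * h2
  have e1 : (n 0 ^ 2 + n 1 ^ 2) * (y 1 - y' 1) = 0 := by linear_combination (n 1) * h1 + (n 0) * h2
  have d0 : y 0 - y' 0 = 0 := (mul_eq_zero.1 e0).resolve_left hn2
  have d1 : y 1 - y' 1 = 0 := (mul_eq_zero.1 e1).resolve_left hn2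
  ext i; fin_cases i
  · exact sub_eq_zero.1 d0
  · exact sub_eq_zero.1 d1

/-- The determinant identity `⟨n,d₁⟩⟨perp n,d₂⟩ − ⟨n,d₂⟩⟨perp n,d₁⟩ = |n|²·cross d₁ d₂`. [folklore] -/
theorem det_identity (n d₁ d₂ : Fin 2 → ℝ) :
    (n ⬝ᵥ d₁) * (perp n ⬝ᵥ d₂) - (n ⬝ᵥ d₂) * (perp n ⬝ᵥ d₁) = (n 0 ^ 2 + n 1 ^ 2) * cross d₁ d₂ := by
  simp only [dot_two, perp_zero, perp_one, cross]; ring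

/-- Two vectors orthogonal to a non-zero `n` are parallel. [folklore] -/
theorem cross_eq_zero_of_dot_eq_zero {n d₁ d₂ : Fin 2 → ℝ} (hn : n ≠ 0) (h1 : n ⬝ᵥ d₁ = 0) (h2 : n ⬝ᵥ d₂ = 0) :
    cross d₁ d₂ = 0 := by
  have h := det_identity n d₁ d₂
  rw [h1, h2, zero_mul, zero_mul, sub_zero] at h
  have hn2 : n 0 ^ 2 + n 1 ^ 2 ≠ 0 := (normSq_pos hn).ne'
  exact (mul_eq_zero.1 h.symm).resolve_left hn2

/-! ### Faces, edge normals, ends -/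

/-- The face of the finite set `F` with outward normal `n`: its points maximising `⟨n, ·⟩`. -/
noncomputable def face (F : Finset (Fin 2 → ℝ)) (n : Fin 2 → ℝ) : Finset (Fin 2 → ℝ) :=
  F.filter fun y => ∀ z ∈ F, n ⬝ᵥ z ≤ n ⬝ᵥ y

/-- `n` is an EDGE NORMAL of `F`: `n ≠ 0` and the face of `F` in direction `n` has two distinct points. -/
def IsEdgeNormal (F : Finset (Fin 2 → ℝ)) (n : Fin 2 → ℝ) : Prop :=
  n ≠ 0 ∧ ∃ p ∈ face F n, ∃ q ∈ face F n, p ≠ q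

/-- `p` is the END of the face of `F` in direction `n`: the strict `perp n`-top of the face. -/
def IsEnd (F : Finset (Fin 2 → ℝ)) (n p : Fin 2 → ℝ) : Prop :=
  IsStrictTop (perp n) (face F n) p

/-- Membership in a face. [folklore] -/
theorem mem_face {F : Finset (Fin 2 → ℝ)} {n y : Fin 2 → ℝ} :
    y ∈ face F n ↔ y ∈ F ∧ ∀ z ∈ F, n ⬝ᵥ z ≤ n ⬝ᵥ y := Finset.mem_filter

/-- Two points of a face have the same height. [folklore] -/
theorem dot_eq_of_mem_face {F : Finset (Fin 2 → ℝ)} {n y y' : Fin 2 → ℝ} (hy : y ∈ face F n) (hy' : y' ∈ face F n) :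
    n ⬝ᵥ y = n ⬝ᵥ y' :=
  le_antisymm ((mem_face.1 hy').2 y (mem_face.1 hy).1) ((mem_face.1 hy).2 y' (mem_face.1 hy').1)

/-- A nonempty finite set has a nonempty face in every direction. [folklore] -/
theorem face_nonempty {F : Finset (Fin 2 → ℝ)} (hF : F.Nonempty) (n : Fin 2 → ℝ) : (face F n).Nonempty := by
  obtain ⟨y, hy, hmax⟩ := F.exists_max_image (fun z => n ⬝ᵥ z) hF
  exact ⟨y, mem_face.2 ⟨hy, hmax⟩⟩

/-- Every direction `n ≠ 0` has an end on a nonempty finite set. [folklore] -/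
theorem exists_isEnd {F : Finset (Fin 2 → ℝ)} (hF : F.Nonempty) {n : Fin 2 → ℝ} (hn : n ≠ 0) : ∃ p, IsEnd F n p := by
  obtain ⟨p, hp, hmax⟩ := (face F n).exists_max_image (fun z => perp n ⬝ᵥ z) (face_nonempty hF n)
  refine ⟨p, hp, fun y hy hne => lt_of_le_of_ne (hmax y hy) fun heq => hne ?_⟩
  exact eq_of_dot_eq hn (dot_eq_of_mem_face hy hp) heq

/-- Positive rescaling does not change the face. [folklore] -/
theorem face_smul {F : Finset (Fin 2 → ℝ)} {n : Fin 2 → ℝ} {c : ℝ} (hc : 0 < c) : face F (c • n) = face F n := by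
  ext y
  simp only [mem_face, smul_dotProduct, smul_eq_mul]
  constructor
  · rintro ⟨hy, h⟩; exact ⟨hy, fun z hz => le_of_mul_le_mul_left (h z hz) hc⟩
  · rintro ⟨hy, h⟩; exact ⟨hy, fun z hz => mul_le_mul_of_nonneg_left (h z hz) hc.le⟩

/-- `perp` is homogeneous. [folklore] -/
theorem perp_smul (c : ℝ) (n : Fin 2 → ℝ) : perp (c • n) = c • perp n := by
  ext i; fin_cases i <;> simp [perp]

/-- Positive rescaling does not change ends. [folklore] -/
theorem IsEnd.of_sameDir {F : Finset (Fin 2 → ℝ)} {n n' p : Fin 2 → ℝ} (h : IsEnd F n p) (hs : SameDir n n') :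
    IsEnd F n' p := by
  obtain ⟨c, hc, rfl⟩ := hs
  unfold IsEnd
  rw [face_smul hc, perp_smul]
  exact h.smul_pos hc

/-- **Ends are hull vertices**: the end of the face in direction `n` is the strict top of `F` for `n + ε·perp n`, `ε > 0`
small. [folklore] -/
theorem IsEnd.mem_extremePoints {F : Finset (Fin 2 → ℝ)} {n p : Fin 2 → ℝ} (h : IsEnd F n p) :
    p ∈ (convexHull ℝ (F : Set (Fin 2 → ℝ))).extremePoints ℝ := by
  classical
  have hpF : p ∈ F := (mem_face.1 h.1).1
  have hF : F.Nonempty := ⟨p, hpF⟩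
  -- bound for the perpendicular deviations
  obtain ⟨yM, -, hM⟩ := F.exists_max_image (fun y => |perp n ⬝ᵥ y - perp n ⬝ᵥ p|) hF
  set M := |perp n ⬝ᵥ yM - perp n ⬝ᵥ p| with hMdef
  have hM0 : 0 ≤ M := abs_nonneg _
  -- the gap below the face
  by_cases hlow : (F.filter fun y => n ⬝ᵥ y < n ⬝ᵥ p).Nonempty
  · obtain ⟨yg, hyg, hg⟩ := (F.filter fun y => n ⬝ᵥ y < n ⬝ᵥ p).exists_max_image (fun y => n ⬝ᵥ y) hlow
    set γ := n ⬝ᵥ p - n ⬝ᵥ yg with hγdef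
    have hγ : 0 < γ := by have := (Finset.mem_filter.1 hyg).2; rw [hγdef]; linarith
    apply IsStrictTop.mem_extremePoints (w := n + (γ / (M + 1)) • perp n)
    refine ⟨hpF, fun y hy hne => ?_⟩
    rw [add_dotProduct, add_dotProduct, smul_dotProduct, smul_dotProduct, smul_eq_mul, smul_eq_mul]
    by_cases hlt : n ⬝ᵥ y < n ⬝ᵥ p
    · have h1 : n ⬝ᵥ y ≤ n ⬝ᵥ yg := hg y (Finset.mem_filter.2 ⟨hy, hlt⟩)
      have h2 : |perp n ⬝ᵥ y - perp n ⬝ᵥ p| ≤ M := hM y hy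
      have h3 : γ / (M + 1) * |perp n ⬝ᵥ y - perp n ⬝ᵥ p| ≤ γ / (M + 1) * M :=
        mul_le_mul_of_nonneg_left h2 (by positivity)
      have h4 : γ / (M + 1) * M < γ := by
        rw [div_mul_eq_mul_div, div_lt_iff₀ (by positivity)]; nlinarith
      have h5 : |γ / (M + 1) * (perp n ⬝ᵥ y - perp n ⬝ᵥ p)| ≤ γ / (M + 1) * M := by
        rw [abs_mul, abs_of_pos (by positivity : (0 : ℝ) < γ / (M + 1))]; exact h3
      have h6 := (abs_le.1 h5).2
      have h7 : γ / (M + 1) * (perp n ⬝ᵥ y - perp n ⬝ᵥ p) = γ / (M + 1) * (perp n ⬝ᵥ y) - γ / (M + 1) * (perp n ⬝ᵥ p) := by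
        ring
      linarith
    · -- `y` is in the face: strictly smaller perpendicular pairing
      have hle : n ⬝ᵥ y ≤ n ⬝ᵥ p := (mem_face.1 h.1).2 y hy
      have heq : n ⬝ᵥ y = n ⬝ᵥ p := le_antisymm hle (not_lt.1 hlt)
      have hyf : y ∈ face F n := mem_face.2 ⟨hy, fun z hz => heq ▸ (mem_face.1 h.1).2 z hz⟩
      have hlt' : perp n ⬝ᵥ y < perp n ⬝ᵥ p := h.2 y hyf hne
      have : γ / (M + 1) * (perp n ⬝ᵥ y) < γ / (M + 1) * (perp n ⬝ᵥ p) := mul_lt_mul_of_pos_left hlt' (by positivity)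
      linarith
  · -- no point below the face: `perp n` alone (plus `n`) works with `ε = 1`
    apply IsStrictTop.mem_extremePoints (w := n + perp n)
    refine ⟨hpF, fun y hy hne => ?_⟩
    rw [add_dotProduct, add_dotProduct]
    have hle : n ⬝ᵥ y ≤ n ⬝ᵥ p := (mem_face.1 h.1).2 y hy
    have hnlt : ¬ n ⬝ᵥ y < n ⬝ᵥ p := fun hlt => hlow ⟨y, Finset.mem_filter.2 ⟨hy, hlt⟩⟩
    have heq : n ⬝ᵥ y = n ⬝ᵥ p := le_antisymm hle (not_lt.1 hnlt)
    have hyf : y ∈ face F n := mem_face.2 ⟨hy, fun z hz => heq ▸ (mem_face.1 h.1).2 z hz⟩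
    have hlt' : perp n ⬝ᵥ y < perp n ⬝ᵥ p := h.2 y hyf hne
    linarith

/-- **Two edge normals with the same end are positive multiples.** [folklore] -/
theorem sameDir_of_isEnd {F : Finset (Fin 2 → ℝ)} {n n' p : Fin 2 → ℝ} (hn : IsEdgeNormal F n) (hn' : IsEdgeNormal F n')
    (h : IsEnd F n p) (h' : IsEnd F n' p) : SameDir n n' := by
  -- a second point of each face
  have key : ∀ {m m' : Fin 2 → ℝ}, IsEdgeNormal F m → IsEnd F m p → IsEnd F m' p → 0 ≤ m' ⬝ᵥ perp m := by
    intro m m' hm hme hm'e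
    obtain ⟨hm0, p₀, hp₀, q₀, hq₀, hne₀⟩ := hm
    -- a point `q ≠ p` of the face of `m`
    obtain ⟨q, hq, hqp⟩ : ∃ q ∈ face F m, q ≠ p := by
      by_cases hp : p₀ = p
      · exact ⟨q₀, hq₀, fun h0 => hne₀ (hp.trans h0.symm)⟩
      · exact ⟨p₀, hp₀, hp⟩
    have hd1 : m ⬝ᵥ (q - p) = 0 := by rw [dotProduct_sub, dot_eq_of_mem_face hq hme.1, sub_self]
    have hd2 : perp m ⬝ᵥ (q - p) < 0 := by rw [dotProduct_sub]; linarith [hme.2 q hq hqp]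
    have hd3 : m' ⬝ᵥ (q - p) ≤ 0 := by
      rw [dotProduct_sub]; linarith [(mem_face.1 hm'e.1).2 q (mem_face.1 hq).1]
    -- `|m|² ⟨m', d⟩ = ⟨perp m, d⟩ ⟨m', perp m⟩`
    have hd1' : m 0 * (q - p) 0 + m 1 * (q - p) 1 = 0 := by rw [← dot_two]; exact hd1
    have hid : (m 0 ^ 2 + m 1 ^ 2) * (m' ⬝ᵥ (q - p)) = (perp m ⬝ᵥ (q - p)) * (m' ⬝ᵥ perp m) := by
      rw [dot_two m' (q - p), dot_two (perp m) (q - p), dot_two m' (perp m), perp_zero, perp_one]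
      linear_combination (m 0 * m' 0 + m 1 * m' 1) * hd1'
    have hpos : 0 < m 0 ^ 2 + m 1 ^ 2 := normSq_pos hm0
    by_contra hlt
    rw [not_le] at hlt
    have e1 : 0 < (perp m ⬝ᵥ (q - p)) * (m' ⬝ᵥ perp m) := mul_pos_of_neg_of_neg hd2 hlt
    have e2 : (m 0 ^ 2 + m 1 ^ 2) * (m' ⬝ᵥ (q - p)) ≤ 0 := mul_nonpos_iff.2 (Or.inl ⟨hpos.le, hd3⟩)
    linarith
  have h1 : 0 ≤ n' ⬝ᵥ perp n := key hn h h'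
  have h2 : 0 ≤ n ⬝ᵥ perp n' := key hn' h' h
  rw [dot_perp_comm] at h2
  have hzero : n' ⬝ᵥ perp n = 0 := le_antisymm (by linarith) h1
  -- so `n'` is a multiple of `n`: `|n|² n' = ⟨n, n'⟩ n`
  obtain ⟨hn0, -⟩ := hn
  obtain ⟨hn0', p₁, hp₁, q₁, hq₁, hne₁⟩ := hn'
  have hnn : 0 < n 0 ^ 2 + n 1 ^ 2 := normSq_pos hn0
  set c := (n ⬝ᵥ n') / (n 0 ^ 2 + n 1 ^ 2) with hc
  have hz' : perp n ⬝ᵥ n' = 0 := by rw [dotProduct_comm]; exact hzero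
  have hmul : n' = c • n := by
    apply eq_of_dot_eq hn0
    · rw [dotProduct_smul, smul_eq_mul, hc]
      have hsq : n ⬝ᵥ n = n 0 ^ 2 + n 1 ^ 2 := by rw [dot_two]; ring
      rw [hsq, div_mul_cancel₀ _ hnn.ne']
    · rw [dotProduct_smul, smul_eq_mul, hz']
      have h0 : perp n ⬝ᵥ n = 0 := by rw [dot_two, perp_zero, perp_one]; ring
      rw [h0, mul_zero]
  -- the multiple is positive: otherwise `p` would be both the `perp n`-top and the `perp n`-bottom of a two-point face
  rcases lt_trichotomy c 0 with hneg | hzero' | hpos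
  · exfalso
    -- with `c < 0`, `⟨n, ·⟩` is constant on `F`, both faces are `F`, and `p` is top and bottom of `perp n`
    have hconst : ∀ y ∈ F, n ⬝ᵥ y = n ⬝ᵥ p := by
      intro y hy
      have h1 := (mem_face.1 h.1).2 y hy
      have h2 := (mem_face.1 h'.1).2 y hy
      rw [hmul, smul_dotProduct, smul_dotProduct, smul_eq_mul, smul_eq_mul] at h2
      nlinarith
    have hfaceF : ∀ y ∈ F, y ∈ face F n := fun y hy =>
      mem_face.2 ⟨hy, fun z hz => by rw [hconst y hy, hconst z hz]⟩
    obtain ⟨q, hq, hqp⟩ : ∃ q ∈ face F n', q ≠ p := by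
      by_cases hp : p₁ = p
      · exact ⟨q₁, hq₁, fun h0 => hne₁ (hp.trans h0.symm)⟩
      · exact ⟨p₁, hp₁, hp⟩
    have hqF : q ∈ F := (mem_face.1 hq).1
    have lt1 : perp n ⬝ᵥ q < perp n ⬝ᵥ p := h.2 q (hfaceF q hqF) hqp
    have lt2 : perp n' ⬝ᵥ q < perp n' ⬝ᵥ p := h'.2 q hq hqp
    rw [hmul, perp_smul, smul_dotProduct, smul_dotProduct, smul_eq_mul, smul_eq_mul] at lt2
    nlinarith
  · exfalso; apply hn0'; rw [hmul, hzero', zero_smul]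
  · exact ⟨c, hpos, hmul⟩

/-- **Counting ends.**  A family of edge normals, pairwise not positive multiples, with chosen ends: the ends are pairwise distinct
hull vertices, so the family is no larger than the vertex count. [folklore] -/
theorem card_le_ncard_extremePoints {ι : Type*} (F : Finset (Fin 2 → ℝ)) (I : Finset ι) (f : ι → Fin 2 → ℝ)
    (e : ι → Fin 2 → ℝ) (hf : ∀ i ∈ I, IsEdgeNormal F (f i)) (he : ∀ i ∈ I, IsEnd F (f i) (e i))
    (hpair : ∀ i ∈ I, ∀ j ∈ I, i ≠ j → ¬ SameDir (f i) (f j)) :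
    I.card ≤ ((convexHull ℝ (F : Set (Fin 2 → ℝ))).extremePoints ℝ).ncard := by
  classical
  have hinj : Set.InjOn e I := by
    intro i hi j hj hij
    by_contra hne
    exact hpair i hi j hj hne (sameDir_of_isEnd (hf i hi) (hf j hj) (he i hi) (hij ▸ he j hj))
  rw [← Finset.card_image_of_injOn hinj, ← Set.ncard_coe_finset]
  refine Set.ncard_le_ncard (fun p hp => ?_) (F.finite_toSet.subset extremePoints_convexHull_subset)
  obtain ⟨i, hi, rfl⟩ := Finset.mem_image.1 (Finset.mem_coe.1 hp)
  exact (he i hi).mem_extremePoints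

/-! ### Faces of a Minkowski sum -/

/-- The face of `X + Y` is the sum of the faces. [folklore] -/
theorem mem_face_add {X Y : Finset (Fin 2 → ℝ)} {n z : Fin 2 → ℝ} :
    z ∈ face (X + Y) n ↔ ∃ x ∈ face X n, ∃ y ∈ face Y n, z = x + y := by
  classical
  constructor
  · intro hz
    obtain ⟨hzXY, hmax⟩ := mem_face.1 hz
    obtain ⟨x, hx, y, hy, rfl⟩ := Finset.mem_add.1 hzXY
    refine ⟨x, mem_face.2 ⟨hx, fun x' hx' => ?_⟩, y, mem_face.2 ⟨hy, fun y' hy' => ?_⟩, rfl⟩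
    · have := hmax (x' + y) (Finset.add_mem_add hx' hy)
      rw [dotProduct_add, dotProduct_add] at this; linarith
    · have := hmax (x + y') (Finset.add_mem_add hx hy')
      rw [dotProduct_add, dotProduct_add] at this; linarith
  · rintro ⟨x, hx, y, hy, rfl⟩
    obtain ⟨hxX, hxm⟩ := mem_face.1 hx
    obtain ⟨hyY, hym⟩ := mem_face.1 hy
    refine mem_face.2 ⟨Finset.add_mem_add hxX hyY, fun z hz => ?_⟩
    obtain ⟨x', hx', y', hy', rfl⟩ := Finset.mem_add.1 hz
    rw [dotProduct_add, dotProduct_add]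
    exact add_le_add (hxm x' hx') (hym y' hy')

/-- The face of a sum, as a Finset identity. [folklore] -/
theorem face_add {X Y : Finset (Fin 2 → ℝ)} {n : Fin 2 → ℝ} : face (X + Y) n = face X n + face Y n := by
  classical
  ext z
  rw [mem_face_add, Finset.mem_add]
  constructor
  · rintro ⟨x, hx, y, hy, rfl⟩; exact ⟨x, hx, y, hy, rfl⟩
  · rintro ⟨x, hx, y, hy, rfl⟩; exact ⟨x, hx, y, hy, rfl⟩

/-- **Ends add up.** [folklore] -/
theorem IsEnd.add {X Y : Finset (Fin 2 → ℝ)} {n p u : Fin 2 → ℝ} (hp : IsEnd X n p) (hu : IsEnd Y n u) :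
    IsEnd (X + Y) n (p + u) := by
  unfold IsEnd
  rw [face_add]
  exact IsStrictTop.add hp hu

/-- **An edge normal of `X` is an edge normal of `X + Y`.** [folklore] -/
theorem IsEdgeNormal.add_right {X Y : Finset (Fin 2 → ℝ)} {n : Fin 2 → ℝ} (h : IsEdgeNormal X n) (hY : Y.Nonempty) :
    IsEdgeNormal (X + Y) n := by
  obtain ⟨hn, p, hp, q, hq, hne⟩ := h
  obtain ⟨y, hy⟩ := face_nonempty hY n
  refine ⟨hn, p + y, mem_face_add.2 ⟨p, hp, y, hy, rfl⟩, q + y, mem_face_add.2 ⟨q, hq, y, hy, rfl⟩, ?_⟩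
  exact fun heq => hne (add_right_cancel heq)

/-- An edge normal of `Y` is an edge normal of `X + Y`. [folklore] -/
theorem IsEdgeNormal.add_left {X Y : Finset (Fin 2 → ℝ)} {n : Fin 2 → ℝ} (h : IsEdgeNormal Y n) (hX : X.Nonempty) :
    IsEdgeNormal (X + Y) n := by
  rw [add_comm]; exact h.add_right hX

end MinkowskiExact

end TotalsLaw

end Summit.ValiantsHypothesis.ValiantsHypothesis.Theorems.NewtonUnitEquationsDissociatedUniform
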